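import Summits.Ventures.HSemireg.WedgeHankelRecurrenceRouthAlgorithm
import Summits.Ventures.HSemireg.WedgeHankelRecurrenceSchurNecessary

/-!
# Venture HSemireg — SCHUR STABILITY OF A REAL POLYNOMIAL BY ROUTH–HURWITZ DATA OF ITS MÖBIUS TRANSFORM (the «bilinear-transform method»), AND VIETA'S NECESSARY BOUNDS `|a_{n−k}| < C(n,k)·|a_n|`:
# for real `p` of degree `n` with `p(1) ≠ 0` and `q = (z−1)ⁿ p((z+1)/(z−1))` (N205 `cayleyPoly n p`, leading coefficient `p(1)`), **all roots of `p` lie in the open unit disc iff `p(1)^k · Δ_k(q) > 0`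
# for all `k ≤ n` iff Routh's first-column test for `q` holds**; and for a complex polynomial with all roots in the open unit disc every coefficient satisfies `‖a_{n−k}‖ < C(n,k)·‖a_n‖` (`1 ≤ k ≤ n`),
# in particular Jury's `|a_0| < |a_n|`

HONEST FRAMING. Part of the Lean index of the computation cell `pub-hsemireg` (seat p10 gen 39, Sunday typer «UNIFORM-IN-n»).
ROOTS OF POLYNOMIALS IN `ℂ`, ELEMENTARY SYMMETRIC FUNCTIONS AND DETERMINANTS ONLY (Mathlib `Polynomial.roots`, `Multiset.esymm`, `Polynomial.coeff_eq_esymm_roots_of_card`, `Matrix.det`): no variety,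
no cohomology theory, no sheaf, no Ext group and no semiregularity map is constructed here; nothing here says that HC / HC_CM / HC_AV holds; no Literature fact (unproved `Prop`) is declared or
used.  Custodian versions as in `WedgeHankelSiegelIdeal` (1/3).
SOURCES (cited).  (1) P. A. Fuhrmann, U. Helmke, *The Mathematics of Networks of Linear Systems* (2015) §5.5 Ex. 5.14 (the Möbius ∕ Cayley transform `z ↦ (z+1)/(z−1)` exchanging the open unit
disc and the open left half-plane; typed as N205 `forall_norm_lt_one_iff_cayleyPoly_real`) combined with Gantmacher Ch. XV §6 (35)–(36) (N211) and §3 Routh's criterion (N212): the classical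
«bilinear-transform» reduction of Schur–Cohn ∕ Jury stability to Routh–Hurwitz.  (2) Vieta's formulas (Mathlib `Polynomial.coeff_eq_esymm_roots_of_card`): `a_{n−k} = (−1)^k a_n e_k(z_1, …, z_n)`,
whence `|a_{n−k}| ≤ Σ_{|S|=k} ∏_{i∈S} |z_i| < C(n,k)` for `|z_i| < 1` — folklore necessary conditions for Schur stability (E. I. Jury's first table conditions `|a_0| < |a_n|`; M. Marden,
*Geometry of Polynomials* (1966) §43).
DEDUP DISCLOSURE (`rg -i 'schur|jury|esymm.*norm|norm.*esymm'` of the HSemireg leaves + `lean search`, 2026-09-02): N193–N195 (Schur–Cohn matrix criterion), N205 (Cayley transform,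
`S_n(p) ≻ 0 ⟺ H_n(q) ≻ 0`), N207 (degree 2), N209 (`p(1) > 0`, `(−1)ⁿp(−1) > 0`, coefficients of `q` positive) — no determinant ∕ Routh-table form of the Schur test and no Vieta coefficient bound
in the tree; Literature `StablePolynomials.SamePhase` concerns real-rooted polynomials.  The 7 names below: 0 hits tree-wide.

WHAT IS IN THE TREE.  N205: `cayleyPoly`, `natDegree_cayleyPoly`, `coeff_cayleyPoly_self`, `forall_norm_lt_one_iff_cayleyPoly_real`; N209: `eval_one_ne_zero_of_forall_norm_lt_one`; N211:
`forall_re_neg_iff_forall_pow_mul_det_hurwitzMatrix_pos`, `forall_re_neg_iff_forall_det_hurwitzMatrix_pos`; N212: `routhTransform`, `forall_re_neg_iff_routh`.  Mathlib: `IsAlgClosed.splits`,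
`Polynomial.splits_iff_card_roots`, `Polynomial.coeff_eq_esymm_roots_of_card`, `Multiset.esymm`, `Multiset.powersetCard`, `Multiset.card_powersetCard`, `norm_multiset_sum_le`,
`Multiset.sum_lt_sum_of_nonempty`.
THIS FILE (namespace `Summit.Ventures.HSemireg.Wedge.HankelOuter` continued; CHAINED on N212, PLAIN on N209; 0 definitions):
* §918 THE BILINEAR-TRANSFORM TESTS (real `p`, `deg p = n`): **`forall_norm_lt_one_iff_forall_pow_mul_det_hurwitzMatrix_cayleyPoly_pos`** (`p(1) ≠ 0`: Schur ⟺ `p(1)^k Δ_k(q) > 0`, `k ≤ n`),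
  `forall_norm_lt_one_iff_forall_det_hurwitzMatrix_cayleyPoly_pos` (`p(1) > 0`: Schur ⟺ `Δ_k(q) > 0`), **`forall_norm_lt_one_iff_routh_cayleyPoly`** (`p(1) ≠ 0`: Schur ⟺ the `n` first-column products
  `q^{(i)}_0 q^{(i)}_1` of Routh's scheme for `q` are positive), `forall_norm_lt_one_iff_eval_one_ne_zero_and_routh` (no hypothesis beyond `p ≠ 0`).
* §919 VIETA'S NECESSARY BOUNDS (complex `p`): **`norm_esymm_lt_card_choose`** (`‖e_k(s)‖ < C(|s|, k)` for `1 ≤ k ≤ |s|`, all `‖z‖ < 1`; the folklore product bounds are inlined — they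
  exist privately in `Literature/AlgebraicGeometry/Motives/FrobIntegralPartVanishingLowDegrees`), **`norm_coeff_lt_choose_mul_norm_leadingCoeff`** (Schur, `deg p = n`, `1 ≤ k ≤ n`: `‖a_{n−k}‖ < C(n,k)·‖a_n‖`), `norm_coeff_zero_lt_norm_leadingCoeff` (Jury: `‖a_0‖ < ‖a_n‖`, `n ≥ 1`).
CAVEATS.  §918 is for REAL polynomials (N205's real form; the complex form would go through N186 instead of N211); §919 is necessary only.  Nothing Ext-side.  New names only.
-/

open Module Polynomial
open scoped Matrix Polynomial

namespace Summit.Ventures.HSemireg.Wedge.HankelOuter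

open Summit.Ventures.HSemireg.Wedge Summit.Ventures.HSemireg.Wedge.Hankel

/-! ## §918. Schur stability through the Routh–Hurwitz data of the Cayley transform -/

/-- **Schur ⟺ `p(1)^k · Δ_k(q) > 0` for all `k ≤ n`**, `q = cayleyPoly n p = (z−1)ⁿp((z+1)/(z−1))` (degree `n`, leading coefficient `p(1)`), for real `p` of degree `n` with `p(1) ≠ 0`.
[F–H Ex. 5.14 + Gantmacher XV §6 (35); this file, §918] -/
theorem forall_norm_lt_one_iff_forall_pow_mul_det_hurwitzMatrix_cayleyPoly_pos {n : ℕ} {p : ℝ[X]} (hp : p.natDegree = n) (h1 : p.eval 1 ≠ 0) :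
    (∀ z ∈ (p.map (algebraMap ℝ ℂ)).roots, ‖z‖ < 1) ↔ ∀ k ≤ n, 0 < p.eval 1 ^ k * (hurwitzMatrix k (cayleyPoly n p)).det := by
  have hq : (cayleyPoly n p).natDegree = n := natDegree_cayleyPoly hp.le h1
  have hlc : (cayleyPoly n p).leadingCoeff = p.eval 1 := by rw [leadingCoeff, hq, coeff_cayleyPoly_self hp.le]
  have hq0 : cayleyPoly n p ≠ 0 := fun h => h1 (by rw [← hlc, h, leadingCoeff_zero])
  rw [forall_norm_lt_one_iff_cayleyPoly_real hp h1, forall_re_neg_iff_forall_pow_mul_det_hurwitzMatrix_pos hq hq0, hlc]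

/-- **Schur ⟺ `Δ_k(q) > 0` for all `k ≤ n`** when `p(1) > 0`. [F–H Ex. 5.14 + Gantmacher XV §6 (36); this file, §918] -/
theorem forall_norm_lt_one_iff_forall_det_hurwitzMatrix_cayleyPoly_pos {n : ℕ} {p : ℝ[X]} (hp : p.natDegree = n) (h1 : 0 < p.eval 1) :
    (∀ z ∈ (p.map (algebraMap ℝ ℂ)).roots, ‖z‖ < 1) ↔ ∀ k ≤ n, 0 < (hurwitzMatrix k (cayleyPoly n p)).det := by
  have hq : (cayleyPoly n p).natDegree = n := natDegree_cayleyPoly hp.le h1.ne'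
  have hlc : (cayleyPoly n p).leadingCoeff = p.eval 1 := by rw [leadingCoeff, hq, coeff_cayleyPoly_self hp.le]
  rw [forall_norm_lt_one_iff_cayleyPoly_real hp h1.ne', forall_re_neg_iff_forall_det_hurwitzMatrix_pos hq (by rwa [hlc])]

/-- **Schur ⟺ Routh's first-column test on the Cayley transform: all `q^{(i)}_0 · q^{(i)}_1 > 0`, `i < n`** (`q^{(i)} = routhTransform^[i] q`; `p(1) ≠ 0`). [F–H Ex. 5.14 + Routh's criterion (N212); this file, §918] -/
theorem forall_norm_lt_one_iff_routh_cayleyPoly {n : ℕ} {p : ℝ[X]} (hp : p.natDegree = n) (h1 : p.eval 1 ≠ 0) :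
    (∀ z ∈ (p.map (algebraMap ℝ ℂ)).roots, ‖z‖ < 1) ↔ ∀ i < n, 0 < (routhTransform^[i] (cayleyPoly n p)).coeff 0 * (routhTransform^[i] (cayleyPoly n p)).coeff 1 := by
  rw [forall_norm_lt_one_iff_cayleyPoly_real hp h1, forall_re_neg_iff_routh (natDegree_cayleyPoly hp.le h1)]

/-- **Schur ⟺ `p(1) ≠ 0 ∧` Routh's first-column test for `q`**, for every real `p ≠ 0` of degree `n` (N209: a Schur-stable `p` has `p(1) ≠ 0`). [this file, §918] -/
theorem forall_norm_lt_one_iff_eval_one_ne_zero_and_routh {n : ℕ} {p : ℝ[X]} (hp : p.natDegree = n) (hp0 : p ≠ 0) :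
    (∀ z ∈ (p.map (algebraMap ℝ ℂ)).roots, ‖z‖ < 1) ↔ p.eval 1 ≠ 0 ∧ ∀ i < n, 0 < (routhTransform^[i] (cayleyPoly n p)).coeff 0 * (routhTransform^[i] (cayleyPoly n p)).coeff 1 := by
  constructor
  · intro h
    have h1 := eval_one_ne_zero_of_forall_norm_lt_one hp0 h
    exact ⟨h1, (forall_norm_lt_one_iff_routh_cayleyPoly hp h1).1 h⟩
  · rintro ⟨h1, h⟩
    exact (forall_norm_lt_one_iff_routh_cayleyPoly hp h1).2 h

/-! ## §919. Vieta's necessary bounds for Schur stability -/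

/-- **`‖e_k(z_1, …, z_m)‖ < C(m, k)` for `1 ≤ k ≤ m` when all `‖z_i‖ < 1`** (each of the `C(m,k)` products has norm `< 1`). [folklore; this file, §919] -/
theorem norm_esymm_lt_card_choose {s : Multiset ℂ} (h : ∀ z ∈ s, ‖z‖ < 1) {k : ℕ} (hk1 : 1 ≤ k) (hk : k ≤ Multiset.card s) : ‖s.esymm k‖ < (Multiset.card s).choose k := by
  -- (the two folklore facts «a product of numbers of norm `≤ 1` ∕ `< 1` has norm `≤ 1` ∕ `< 1`» exist PRIVATELY in `Literature/AlgebraicGeometry/Motives/FrobIntegralPartVanishingLowDegrees`; inlined)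
  have hle : ∀ t : Multiset ℂ, (∀ z ∈ t, ‖z‖ ≤ 1) → ‖t.prod‖ ≤ 1 := fun t => by
    induction t using Multiset.induction_on with
    | empty => intro; simp
    | cons a t ih =>
      intro ht
      rw [Multiset.prod_cons, norm_mul]
      exact mul_le_one₀ (ht a (Multiset.mem_cons_self a t)) (norm_nonneg _) (ih fun z hz => ht z (Multiset.mem_cons_of_mem hz))
  have hlt : ∀ t : Multiset ℂ, t ≠ 0 → (∀ z ∈ t, ‖z‖ < 1) → ‖t.prod‖ < 1 := fun t ht h' => by
    obtain ⟨a, ha⟩ := Multiset.exists_mem_of_ne_zero ht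
    obtain ⟨t, rfl⟩ := Multiset.exists_cons_of_mem ha
    rw [Multiset.prod_cons, norm_mul]
    calc ‖a‖ * ‖t.prod‖ ≤ ‖a‖ * 1 := mul_le_mul_of_nonneg_left (hle t fun z hz => (h' z (Multiset.mem_cons_of_mem hz)).le) (norm_nonneg a)
      _ < 1 := by rw [mul_one]; exact h' a (Multiset.mem_cons_self a t)
  rw [Multiset.esymm]
  have hne : s.powersetCard k ≠ 0 := by
    rw [Ne, ← Multiset.card_eq_zero, Multiset.card_powersetCard]
    exact (Nat.choose_pos hk).ne'
  calc ‖((s.powersetCard k).map Multiset.prod).sum‖ ≤ (((s.powersetCard k).map Multiset.prod).map fun x => ‖x‖).sum := norm_multiset_sum_le _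
    _ = ((s.powersetCard k).map fun t => ‖t.prod‖).sum := by rw [Multiset.map_map]; rfl
    _ < ((s.powersetCard k).map fun _ => (1 : ℝ)).sum := by
        refine Multiset.sum_lt_sum_of_nonempty hne fun t ht => ?_
        rw [Multiset.mem_powersetCard] at ht
        exact hlt t (by rw [Ne, ← Multiset.card_eq_zero, ht.2]; omega) fun z hz => h z (Multiset.mem_of_le ht.1 hz)
    _ = (Multiset.card s).choose k := by rw [Multiset.map_const', Multiset.sum_replicate, Multiset.card_powersetCard, nsmul_eq_mul, mul_one]

/-- **VIETA'S NECESSARY BOUNDS: if all roots of a complex polynomial `p = a_n Xⁿ + ⋯ + a_0` of degree `n` lie in the open unit disc, then `‖a_{n−k}‖ < C(n,k)·‖a_n‖` for `1 ≤ k ≤ n`**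
(`a_{n−k} = (−1)^k a_n e_k(roots)`). [Vieta; Marden §43 ∕ Jury (folklore); this file, §919] -/
theorem norm_coeff_lt_choose_mul_norm_leadingCoeff {n : ℕ} {p : ℂ[X]} (hp : p.natDegree = n) (h : ∀ z ∈ p.roots, ‖z‖ < 1) {k : ℕ} (hk1 : 1 ≤ k) (hk : k ≤ n) :
    ‖p.coeff (n - k)‖ < n.choose k * ‖p.leadingCoeff‖ := by
  have hp0 : p ≠ 0 := by rintro rfl; rw [natDegree_zero] at hp; omega
  have hcard : Multiset.card p.roots = p.natDegree := splits_iff_card_roots.1 (IsAlgClosed.splits p)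
  have hvieta := coeff_eq_esymm_roots_of_card hcard (k := n - k) (by rw [hp]; omega)
  rw [hp, show n - (n - k) = k by omega] at hvieta
  rw [hvieta, norm_mul, norm_mul, norm_pow, norm_neg, norm_one, one_pow, mul_one, mul_comm]
  have hlc : 0 < ‖p.leadingCoeff‖ := norm_pos_iff.2 (leadingCoeff_ne_zero.2 hp0)
  have := norm_esymm_lt_card_choose h hk1 (by rw [hcard, hp]; exact hk)
  rw [hcard, hp] at this
  exact mul_lt_mul_of_pos_right this hlc

/-- **Jury's first condition `‖a_0‖ < ‖a_n‖`** for a Schur-stable complex polynomial of degree `n ≥ 1` (the product of the roots has norm `< 1`). [Jury (folklore); this file, §919] -/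
theorem norm_coeff_zero_lt_norm_leadingCoeff {n : ℕ} {p : ℂ[X]} (hp : p.natDegree = n) (hn : 1 ≤ n) (h : ∀ z ∈ p.roots, ‖z‖ < 1) : ‖p.coeff 0‖ < ‖p.leadingCoeff‖ := by
  have := norm_coeff_lt_choose_mul_norm_leadingCoeff hp h hn le_rfl
  rwa [Nat.sub_self, Nat.choose_self, Nat.cast_one, one_mul] at this

end Summit.Ventures.HSemireg.Wedge.HankelOuter
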